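import Literature.Probability.LatticeModels.WeaklyCoupledChain
import Mathlib.Analysis.Calculus.Deriv.Pi
import Mathlib.Analysis.Calculus.Deriv.Comp
import Mathlib.Analysis.Calculus.ContDiff.Basic
import HarnessLib

/-!
# Weakly coupled chains: observables with continuous partial derivatives

`Literature/Probability/LatticeModels/` — small companion of `WeaklyCoupledChain.lean`. The
estimates of the `WeaklyCoupledChain*` series are stated for observables `f : ℝ^N → ℝ` given
together with their partial derivatives `f' k = ∂_k f` along the coordinates; this file packages
that datum:

* `BoxChain.HasPartials f f'` — `f` is continuous, every `f' k` is continuous, and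
  `t ↦ f(p[k ↦ t])` has derivative `f' k (p[k ↦ t])` at every `t` (a `Prop`-valued structure);
* `HasPartials.partial_eq_zero` — if `f` does not depend on the coordinate `k` then `f' k = 0`;
* `hasPartials_of_contDiff` — a `C¹` function has partials `∂_k f (q) = Df(q) e_k`, and
  `deriv_comp_update` identifies `d/dt f(q[k ↦ t])|_{t = q_k}` with `Df(q) e_k`.

All [folklore].
-/

noncomputable section

open Function Set

namespace Literature.Probability.LatticeModels

namespace BoxChain

variable {N : ℕ}

/-- The data of a `C¹` observable on `ℝ^N`: continuous, with continuous partial derivatives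
along every coordinate, `f' k` being `∂_k f` in the sense that `t ↦ f(p[k ↦ t])` has derivative
`f' k (p[k ↦ t])`. [folklore] -/
structure HasPartials (f : (Fin N → ℝ) → ℝ) (f' : Fin N → (Fin N → ℝ) → ℝ) : Prop where
  continuous : Continuous f
  continuous_partial : ∀ k, Continuous (f' k)
  hasDerivAt : ∀ (k : Fin N) (p : Fin N → ℝ) (r : ℝ),
    HasDerivAt (fun r => f (update p k r)) (f' k (update p k r)) r

/-- If `f` does not depend on the coordinate `k`, its partial derivative along `k` vanishes. [folklore] -/
theorem HasPartials.partial_eq_zero {f : (Fin N → ℝ) → ℝ} {f' : Fin N → (Fin N → ℝ) → ℝ}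
    (hf : HasPartials f f') {k : Fin N} (hk : DependsOn f {i : Fin N | i ≠ k}) (p : Fin N → ℝ) :
    f' k p = 0 := by
  have hconst : ∀ r, f (update p k r) = f p := fun r =>
    hk fun i hi => by rw [update_of_ne hi]
  have h1 : HasDerivAt (fun r => f (update p k r)) (f' k (update p k (p k))) (p k) := hf.hasDerivAt k p (p k)
  rw [update_eq_self] at h1
  have h2 : HasDerivAt (fun r => f (update p k r)) 0 (p k) := by
    simp_rw [hconst]; exact hasDerivAt_const _ _
  exact h1.unique h2

/-- The chain rule along a coordinate line: for differentiable `f`,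
`t ↦ f(p[k ↦ t])` has derivative `Df(p[k ↦ t]) e_k` at `t`. [folklore] -/
theorem hasDerivAt_comp_update {f : (Fin N → ℝ) → ℝ} (hf : Differentiable ℝ f) (k : Fin N)
    (p : Fin N → ℝ) (t : ℝ) :
    HasDerivAt (fun r => f (update p k r)) (fderiv ℝ f (update p k t) (Pi.single k 1)) t :=
  (hf (update p k t)).hasFDerivAt.comp_hasDerivAt t (hasDerivAt_update p k t)

/-- `d/dt f(q[k ↦ t])|_{t = q_k} = Df(q) e_k` for differentiable `f`. [folklore] -/
theorem deriv_comp_update {f : (Fin N → ℝ) → ℝ} (hf : Differentiable ℝ f) (k : Fin N) (q : Fin N → ℝ) :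
    deriv (fun t => f (update q k t)) (q k) = fderiv ℝ f q (Pi.single k 1) := by
  have h := (hasDerivAt_comp_update hf k q (q k)).deriv
  rwa [update_eq_self] at h

/-- **A `C¹` function has continuous partials** `∂_k f (q) = Df(q) e_k`. [folklore] -/
theorem hasPartials_of_contDiff {f : (Fin N → ℝ) → ℝ} (hf : ContDiff ℝ 1 f) :
    HasPartials f (fun k q => fderiv ℝ f q (Pi.single k 1)) where
  continuous := hf.continuous
  continuous_partial _ := (hf.continuous_fderiv one_ne_zero).clm_apply continuous_const
  hasDerivAt k p r := hasDerivAt_comp_update (hf.differentiable one_ne_zero) k p r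

/-- The same partials in the `deriv` form: for `C¹` `f`, with
`∂_k f (q) := d/dt f(q[k ↦ t])|_{t = q_k}`. [folklore] -/
theorem hasPartials_deriv_of_contDiff {f : (Fin N → ℝ) → ℝ} (hf : ContDiff ℝ 1 f) :
    HasPartials f (fun k q => deriv (fun t => f (update q k t)) (q k)) := by
  have e : (fun (k : Fin N) (q : Fin N → ℝ) => deriv (fun t => f (update q k t)) (q k)) =
      fun k q => fderiv ℝ f q (Pi.single k 1) := by
    funext k q; exact deriv_comp_update (hf.differentiable one_ne_zero) k q
  rw [e]
  exact hasPartials_of_contDiff hf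

end BoxChain

end Literature.Probability.LatticeModels

end
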